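import Literature.AlgebraicGeometry.Motives.TypeIIGenericCommutant
import Literature.AlgebraicGeometry.Motives.WeilTypeIIComplexStructures
import Literature.AlgebraicGeometry.Motives.WeilDiscriminantTypeII
import Literature.AlgebraicGeometry.Motives.WeilOperatorModule
import Literature.AlgebraicGeometry.Motives.WeilDatumDiagonalPoint
import Literature.AlgebraicGeometry.Motives.HodgeStructureK3Type
import Mathlib.RingTheory.AlgebraTower
import Mathlib.RingTheory.TensorProduct.Free
import Mathlib.LinearAlgebra.FiniteDimensional.Lemmas
import HarnessLib

/-!
# The generic member of the type-II Weil family has endomorphism algebra `D = K ⊕ Kj`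
# (Shimura 1963 §4 / van Geemen's proof of Thm. 6.11 — fixed-part form, on the rational Weil datum)

Family `hodge`, layer `Literature/AlgebraicGeometry/Motives`; THEOREMS ONLY (no definition, no named fact, no
`sorry`; D-0026). This file closes the type-II genericity story of `Motives/WeilDiscriminantTypeII` (the
`j`-adapted orthogonal `K`-frame of a type-II Weil form), `Motives/WeilTypeIIComplexStructures` (the type-II
sub-domain `𝔖(j) = {J ∈ X⁺(D) : J j_ℝ = j_ℝ J}` of the period domain of a Weil datum is non-empty and carries `j`
as a Hodge endomorphism), `Motives/TypeIIQuaternionFrame` (quaternionic coordinates of a type-II frame and the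
explicit family `J(P, t)`) and `Motives/TypeIIGenericCommutant` (REAL SIDE: an `ℝ`-linear map commuting with
every `J(P, t)` is left multiplication by a real quaternion, `Frame.exists_eq_lam_of_forall_comm_JP`), by the
`WeilDatum` packaging and the `ℚ`-descent:

**for a finite-dimensional Weil datum `D = (V, α, E)` with a type-II operator `j` (`jα = -αj`, `j² = b > 0`,
`E(jx, y) = E(x, jy)`; `D := K ⊕ Kj = (-d, b)_ℚ`), a `ℚ`-linear endomorphism of `V` is a Hodge endomorphism
of EVERY fibre `D.hodgeStructure J`, `J ∈ 𝔖(j)`, if and only if it lies in `ℚ⟨α, j⟩ = ℚ + ℚα + ℚj + ℚαj = D`**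
(`WeilDatum.forall_typeII_mem_endAlg_iff`, `WeilDatum.iInf_endAlg_typeII_eq_adjoin`).

This is the Hodge-theoretic, fixed-part form of Shimura's theorem that the generic member of the analytic
family of polarized abelian varieties of TYPE II (endomorphism structure by an indefinite quaternion algebra
`D/ℚ`, parametrized by a Siegel space) has endomorphism algebra exactly `D` [Shimura1963AnalyticFamilies, §4],
proved by van Geemen's mechanism [vanGeemen1994HodgeAV, proof of Thm. 6.11: "`Hₙ = {gJ'g⁻¹ : g ∈ SU_H(ℝ)}`
… does not lie in any proper linear subspace … the general `J' ∈ Hₙ`"] made completely explicit: already the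
`(n+1)`-parameter real-algebraic sub-family `J(P, t)` of `𝔖(j)` through its diagonal CM point has joint
commutant `D_ℝ`, and `End_ℚ(V) ∩ D_ℝ = D`.

## What is proved (0 sorry)

* §1 `HodgeStructure.mem_endAlg_hodgeStructureOfCx_iff`, `WeilDatum.mem_endAlg_hodgeStructure_iff`: a
  `ℚ`-linear `f` lies in `End_Hdg` (`HodgeStructure.endAlg`: `f_ℂ F^p ⊆ F^p`) of the weight-one Hodge structure
  of a complex structure `J` iff `f_ℝ J = J f_ℝ` (van Geemen 5.7, as an equivalence); hence `α ∈ End_Hdg` of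
  every fibre and `j ∈ End_Hdg` of every fibre over `𝔖(j)`, so `ℚ⟨α, j⟩ ⊆ End_Hdg` there
  (`adjoin_le_endAlg_hodgeStructure_of_comm`).
* §2 **`WeilDatum.exists_typeII_rationalBasis`** (the RATIONAL TYPE-II FRAME): `dim_ℚ V = 4n` and `V` has a
  `ℚ`-basis `xᵢ, αxᵢ, jxᵢ, αjxᵢ` (`i < n`) with pairwise `E`-orthogonal blocks and `E(xᵢ, αxᵢ) > 0` — i.e.
  `(V, E) = ⊕ᵢ D xᵢ` orthogonally. Proof: `V` is a vector space over the FIELD `K = ℚ[X]/(X² + d)` through `α`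
  (`Motives/WeilOperatorModule.exists_module_smul_eq`); take the `j`-adapted `H`-orthogonal `K`-frame
  `eᵢ, jeᵢ` of `Motives/WeilDiscriminantTypeII.exists_typeII_orthogonalFrame`, replace `eᵢ` by `jeᵢ` where
  `Q(eᵢ) < 0` (`Q(jx) = -bQ(x)`, `b > 0`), pass to `ℚ` with the basis `(1, α)` of `K`
  (`linearIndependent_smul`), and read `E = Im H = 0` between distinct blocks off `H = 0`.
* §3 `WeilDatum.exists_typeIIFrame`: its realification is a `TypeIIQuaternionFrame.Frame` on `V_ℝ` with
  `A = α_ℝ`, `B = j_ℝ`, `E = E_ℝ`, `β = √b`, frame basis `1 ⊗ (rational basis)`.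
* §4 `WeilDatum.exists_isWeilComplexStructure_realJ_eq_JP`: for any such frame every member `J(P, t)`
  (`Pᵢ ≠ 0`) of the explicit family IS (the realification of) a point of Deligne's `X⁺(D)`
  (`IsWeilComplexStructure D.hForm J`: `ℂ`-linear on `(V_ℝ, i)`, `J² = -1`, `E(Jx, Jy) = E(x, y)`, `E(x, Jx) > 0`)
  commuting with `j_ℝ` — a point of `𝔖(j)`; **`WeilDatum.exists_eq_of_forall_JP_mem_endAlg`**: a `ℚ`-linear
  `g` that is a Hodge endomorphism at every `J(P, t)` (`Pᵢ > 0`, `t > 0`) is `c₀ + c₁α + c₂j + c₃αj`, `cᵢ ∈ ℚ`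
  (§1 ⟹ `g_ℝ` commutes with the family ⟹ `g_ℝ = λ(δ)`, `δ ∈ D_ℝ`, by `Frame.exists_eq_lam_of_forall_comm_JP`
  ⟹ `δ ∈ ℚ⁴` by reading the coordinates of `g_ℝ(1 ⊗ x₁) = 1 ⊗ g x₁` in the rational frame basis
  ⟹ `g = c₀ + c₁α + c₂j + c₃αj` since `v ↦ 1 ⊗ v` is injective).
* §5 **`WeilDatum.exists_eq_of_forall_typeII_mem_endAlg`** / `mem_adjoin_of_forall_typeII_mem_endAlg` (MAIN):
  `g ∈ End_Hdg(D.hodgeStructure J)` for all `J ∈ 𝔖(j)` ⟹ `g = c₀ + c₁α + c₂j + c₃αj ∈ ℚ⟨α, j⟩`;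
  `forall_typeII_mem_endAlg_iff`, `iInf_endAlg_typeII_eq_adjoin` (`⋂_{𝔖(j)} End_Hdg = ℚ⟨α, j⟩`), and the
  separation form `exists_typeII_not_mem_endAlg` (each `g ∉ D` fails to be Hodge at SOME point of `𝔖(j)`).

CONTEXT (vhodge cell, route SplitImpliesAll, crux `NonsplitSixfoldCells`, memo ROUTE-P3-g17 §3: "the GENERIC
type-II member = a member of a non-split sixfold cell with `End⁰ = D_δ` exactly"): with
`Motives/WeilTypeIIOperatorOfDiscriminant` (every rational Weil datum of odd half-rank `n` and class `[u]`,
`u < 0`, carries a type-II `j` with `j² = -u`) this gives, on every such datum, the family `𝔖(j)` of fibres whose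
COMMON Hodge endomorphism algebra is exactly `D_δ = (-d, -u)_ℚ`.

HONEST REMARKS. (1) This is the FIXED-PART (family) statement; the SINGLE very general member (`End_Hdg = D`
for one `J ∈ 𝔖(j)` outside a countable union of proper analytic subsets — van Geemen's Baire step "since `Hₙ` is
not a countable union of lower dimensional submanifolds") is NOT formalized; what is here is exactly its
algebraic input (for each of the countably many `g ∈ End_ℚ(V) ∖ D` the locus where `g` is Hodge is a proper
subset of `𝔖(j)`, `exists_typeII_not_mem_endAlg`). (2) Nothing here is about abelian varieties: no period map,
no Riemann theorem, no simplicity statement (`D` a division algebra is not used or proved), no Mumford–Tate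
group. (3) `ℚ⟨α, j⟩ = Algebra.adjoin ℚ {α, j}`; that it is `4`-dimensional / isomorphic to `(-d, b)_ℚ` is not
restated here (the explicit form `c₀ + c₁α + c₂j + c₃αj` is what the main theorem delivers).

## References

* [Shimura1963AnalyticFamilies] G. Shimura, On analytic families of polarized abelian varieties and automorphic
  functions, Ann. of Math. 78 (1963) 149–192, §4 (Type II: the domain is a Siegel space; the endomorphism
  algebra of the generic member is the given quaternion algebra).
* [vanGeemen1994HodgeAV] B. van Geemen, An introduction to the Hodge conjecture for abelian varieties, in:
  Algebraic Cycles and Hodge Theory (Torino 1993), LNM 1594 (1994), 5.5–5.8 and proof of Thm. 6.11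
  (held text `book:green1994-algebraic-cycles-hodge-theory-lectures-given-at`, PDF pp. 231–232:
  "`Hₙ = {gJ'g⁻¹ : g ∈ SU_H(ℝ)}` … the general `J' ∈ Hₙ`").
* [vanGeemenVerra2003QuaternionicPryms] B. van Geemen, A. Verra, Quaternionic Pryms and Hodge classes,
  Topology 42 (2003) 35–53, Lemma 4.5 (proof: `F = K ⊕ Kj`, `xj = j x̄`).
* [Deligne1982HodgeCycles] P. Deligne (notes by J. S. Milne), Hodge cycles on abelian varieties, LNM 900 (1982),
  proof of Thm. 4.8, pp. 47–49 (`X⁺`, (a′), (b′)).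
* [Huybrechts2016K3] D. Huybrechts, Lectures on K3 surfaces (2016), §3.3.3 (`End_Hdg` as a `ℚ`-algebra).
-/

noncomputable section

open Module Polynomial
open scoped TensorProduct

namespace Literature.AlgebraicGeometry.Motives

universe u

/-! ## §1 Hodge endomorphisms of the Hodge structure of a complex structure: `f ∈ End_Hdg ↔ f_ℝ J = J f_ℝ` -/

namespace HodgeStructure

variable {V : Type u} [AddCommGroup V] [Module ℚ V]

/-- **`End_Hdg` of the Hodge structure of a complex structure.** For the weight-one `ℚ`-Hodge structure
`hodgeStructureOfCx J` (`V^{1,0} = {a + iJa}`) of a complex structure `J` on `V_ℝ`, a `ℚ`-linear `f` lies in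
`End_Hdg` (its complexification preserves the Hodge filtration) iff its realification COMMUTES with `J`
(`⟸` is `map_F_hodgeStructureOfCx_le`; `⟹`: `f_ℂ(a + iJa) = f_ℝ a + i f_ℝ J a ∈ V^{1,0}` forces
`f_ℝ J a = J f_ℝ a`). [cite: vanGeemen1994HodgeAV, 5.7] [cite: Huybrechts2016K3, §3.3.3] -/
theorem mem_endAlg_hodgeStructureOfCx_iff (J : ℝ ⊗[ℚ] V →ₗ[ℝ] ℝ ⊗[ℚ] V) (hJ : ∀ a, J (J a) = -a)
    (f : V →ₗ[ℚ] V) :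
    f ∈ (hodgeStructureOfCx J hJ).endAlg ↔ ∀ a, f.baseChange ℝ (J a) = J (f.baseChange ℝ a) := by
  refine ⟨fun hf a => ?_, fun hf => map_F_hodgeStructureOfCx_le J hJ f hf⟩
  have h1 := (mem_endAlg_iff _ _).1 hf 1
  rw [hodgeStructureOfCx_F_one] at h1
  have hx : f.baseChange ℂ (mkCx a (J a)) ∈ cxF1 J := h1 ⟨mkCx a (J a), mkCx_mem_cxF1 J hJ a, rfl⟩
  rw [baseChange_mkCx, mem_cxF1_iff, imPart_mkCx, rePart_mkCx] at hx
  exact hx.1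

end HodgeStructure

namespace WeilDatum

variable {V : Type u} [AddCommGroup V] [Module ℚ V] (D : WeilDatum V)

/-- **`End_Hdg` of a fibre of the Weil family**: for `J ∈ X⁺(D)` (or any `ℂ`-linear complex structure of
`(V_ℝ, i)`), a `ℚ`-linear `f` is an endomorphism of the Hodge structure `D.hodgeStructure J` iff `f_ℝ`
commutes with (the realification of) `J` — van Geemen 5.7 "since the complex structure `J` commutes with
the action of `K`, we have `K ⊂ End(X)_ℚ`", as an equivalence. [cite: vanGeemen1994HodgeAV, 5.7] -/
theorem mem_endAlg_hodgeStructure_iff (J : D.Cx →ₗ[ℂ] D.Cx) (hJ : ∀ x, J (J x) = -x)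
    (f : V →ₗ[ℚ] V) :
    f ∈ (D.hodgeStructure J hJ).endAlg ↔
      ∀ a, f.baseChange ℝ (D.realJ J a) = D.realJ J (f.baseChange ℝ a) :=
  HodgeStructure.mem_endAlg_hodgeStructureOfCx_iff (D.realJ J) (D.realJ_realJ J hJ) f

/-- `α = √-d` is a Hodge endomorphism of every fibre (`J` is `K ⊗ ℝ`-linear: Deligne's (a′)).
[cite: vanGeemen1994HodgeAV, 5.7] [cite: Deligne1982HodgeCycles, proof of Thm. 4.8, p. 47 (a′)] -/
theorem α_mem_endAlg_hodgeStructure (J : D.Cx →ₗ[ℂ] D.Cx) (hJ : ∀ x, J (J x) = -x) :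
    D.α ∈ (D.hodgeStructure J hJ).endAlg :=
  (D.mem_endAlg_hodgeStructure_iff J hJ D.α).2 fun a => D.αℝ_realJ J a

/-- A type-II operator `j` is a Hodge endomorphism of every fibre over the type-II sub-domain
`𝔖(j) = {J ∈ X⁺(D) : J j_ℝ = j_ℝ J}` (restates `map_F_hodgeStructure_le_of_comm` in `End_Hdg` form).
[cite: vanGeemen1994HodgeAV, 5.7] [cite: Shimura1963AnalyticFamilies, §4] -/
theorem typeII_mem_endAlg_hodgeStructure (j : V →ₗ[ℚ] V) (J : D.Cx →ₗ[ℂ] D.Cx)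
    (hJ : ∀ x, J (J x) = -x) (hcomm : ∀ a, j.baseChange ℝ (D.realJ J a) = D.realJ J (j.baseChange ℝ a)) :
    j ∈ (D.hodgeStructure J hJ).endAlg :=
  (D.mem_endAlg_hodgeStructure_iff J hJ j).2 hcomm

/-- Hence `ℚ⟨α, j⟩ ⊆ End_Hdg` of every fibre over `𝔖(j)`: the type-II family carries `D = K ⊕ Kj` by Hodge
endomorphisms. [cite: vanGeemen1994HodgeAV, 5.7] [cite: Shimura1963AnalyticFamilies, §4] -/
theorem adjoin_le_endAlg_hodgeStructure_of_comm (j : V →ₗ[ℚ] V) (J : D.Cx →ₗ[ℂ] D.Cx)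
    (hJ : ∀ x, J (J x) = -x) (hcomm : ∀ a, j.baseChange ℝ (D.realJ J a) = D.realJ J (j.baseChange ℝ a)) :
    Algebra.adjoin ℚ {D.α, j} ≤ (D.hodgeStructure J hJ).endAlg := by
  refine Algebra.adjoin_le ?_
  intro x hx
  simp only [Set.mem_insert_iff, Set.mem_singleton_iff] at hx
  rcases hx with rfl | rfl
  · exact D.α_mem_endAlg_hodgeStructure J hJ
  · exact D.typeII_mem_endAlg_hodgeStructure _ J hJ hcomm

end WeilDatum

/-! ## §2 The rational type-II frame of a Weil datum: `V = D x₁ ⊕ … ⊕ D xₙ`, `E`-orthogonal, `E(xᵢ, αxᵢ) > 0` -/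

section AdjoinRoot

/-- `root² = -d` in `ℚ[X]/(X² + d)` (private helper). [folklore] -/
private theorem root_mul_root (d : ℚ) :
    AdjoinRoot.root (X ^ 2 + C d : ℚ[X]) * AdjoinRoot.root (X ^ 2 + C d : ℚ[X]) =
      algebraMap ℚ (AdjoinRoot (X ^ 2 + C d : ℚ[X])) (-d) := by
  have h := AdjoinRoot.eval₂_root (X ^ 2 + C d : ℚ[X])
  rw [eval₂_add, eval₂_X_pow, eval₂_C] at h
  rw [← sq, map_neg, AdjoinRoot.algebraMap_eq]
  exact eq_neg_of_add_eq_zero_left h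

/-- `ℚ[X]/(X² + d) = ℚ + ℚ·root` (private helper; reduce modulo the monic `X² + d`). [folklore] -/
private theorem exists_eq_algebraMap_add_mul_root (d : ℚ) (k : AdjoinRoot (X ^ 2 + C d : ℚ[X])) :
    ∃ a c : ℚ, k = algebraMap ℚ (AdjoinRoot (X ^ 2 + C d : ℚ[X])) a +
      algebraMap ℚ (AdjoinRoot (X ^ 2 + C d : ℚ[X])) c * AdjoinRoot.root (X ^ 2 + C d : ℚ[X]) := by
  induction k using AdjoinRoot.induction_on with
  | ih p =>
    have hmonic : (X ^ 2 + C d : ℚ[X]).Monic := monic_X_pow_add_C _ two_ne_zero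
    have hdeg : (X ^ 2 + C d : ℚ[X]).natDegree = 2 := natDegree_X_pow_add_C
    have hne1 : (X ^ 2 + C d : ℚ[X]) ≠ 1 := fun h1 => by
      have h := congrArg natDegree h1
      rw [hdeg, natDegree_one] at h
      exact absurd h (by norm_num)
    have hmk : AdjoinRoot.mk (X ^ 2 + C d) p =
        AdjoinRoot.mk (X ^ 2 + C d) (p %ₘ (X ^ 2 + C d)) := by
      rw [AdjoinRoot.mk_eq_mk]
      exact ⟨p /ₘ (X ^ 2 + C d),
        sub_eq_iff_eq_add'.mpr (modByMonic_add_div p (X ^ 2 + C d)).symm⟩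
    have hdeg1 : (p %ₘ (X ^ 2 + C d)).natDegree ≤ 1 := by
      have h := natDegree_modByMonic_lt p hmonic hne1
      rw [hdeg] at h
      omega
    obtain ⟨c₁, c₀, hr⟩ := exists_eq_X_add_C_of_natDegree_le_one hdeg1
    refine ⟨c₀, c₁, ?_⟩
    rw [hmk, hr, map_add, map_mul, AdjoinRoot.mk_C, AdjoinRoot.mk_C, AdjoinRoot.mk_X,
      AdjoinRoot.algebraMap_eq]
    exact add_comm _ _

end AdjoinRoot

namespace WeilDatum

variable {V : Type u} [AddCommGroup V] [Module ℚ V] (D : WeilDatum V)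

/-- `Q(j x) = -b Q(x)` for `Q(x) = E(x, αx)` and a type-II operator (`WeilDatum` spelling of `weilQ_j`).
[cite: vanGeemenVerra2003QuaternionicPryms, Lemma 4.5 (proof)] -/
theorem E_typeII_α_typeII (j : V →ₗ[ℚ] V) {b : ℚ} (hjα : ∀ x, j (D.α x) = -(D.α (j x)))
    (hjj : ∀ x, j (j x) = b • x) (hjE : ∀ x y, D.E (j x) y = D.E x (j y)) (x : V) :
    D.E (j x) (D.α (j x)) = -(b * D.E x (D.α x)) := by
  have h1 : D.α (j x) = -j (D.α x) := by rw [hjα, neg_neg]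
  rw [h1, map_neg, hjE, hjj, LinearMap.map_smul, smul_eq_mul]

/-- **The rational type-II frame.** A finite-dimensional Weil datum `D = (V, α, E)` with a type-II operator
`j` (`K`-antilinear: `jα = -αj`; `j² = b > 0`; Rosati-symmetric: `E(jx, y) = E(x, jy)`) has `dim_ℚ V = 4n` and a
`ℚ`-basis `xᵢ, αxᵢ, jxᵢ, αjxᵢ` (`i < n`) whose `n` blocks `D xᵢ = ℚ⟨xᵢ, αxᵢ, jxᵢ, αjxᵢ⟩` are pairwise
`E`-orthogonal, with `E(xᵢ, αxᵢ) > 0`: `(V, E) = ⊕ᵢ D xᵢ` is an orthogonal sum of `D`-lines,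
`D = K ⊕ Kj = (-d, b)_ℚ`. This is the `j`-adapted `H`-orthogonal `K`-frame `xᵢ, jxᵢ` of
`Motives/WeilDiscriminantTypeII.exists_typeII_orthogonalFrame` (over `K = ℚ[X]/(X² + d)` acting through
`α`, `Motives/WeilOperatorModule.exists_module_smul_eq`), each `xᵢ` replaced by `jxᵢ` where `Q(xᵢ) < 0`
(`Q(jx) = -bQ(x)`), written out over `ℚ` with the basis `(1, α)` of `K`.
[cite: vanGeemenVerra2003QuaternionicPryms, Lemma 4.5 (proof)] [cite: vanGeemen1994HodgeAV, Lemma 5.2 (2) and 5.4] -/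
theorem exists_typeII_rationalBasis [FiniteDimensional ℚ V] (j : V →ₗ[ℚ] V) {b : ℚ}
    (hjα : ∀ x, j (D.α x) = -(D.α (j x))) (hjj : ∀ x, j (j x) = b • x)
    (hjE : ∀ x y, D.E (j x) y = D.E x (j y)) (hb : 0 < b) :
    ∃ n : ℕ, finrank ℚ V = 4 * n ∧ ∃ bQ : Basis (Fin n × Fin 4) ℚ V,
      (∀ i, bQ (i, 1) = D.α (bQ (i, 0))) ∧ (∀ i, bQ (i, 2) = j (bQ (i, 0))) ∧
      (∀ i, bQ (i, 3) = D.α (j (bQ (i, 0)))) ∧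
      (∀ i k, i ≠ k → ∀ ε ε', D.E (bQ (i, ε)) (bQ (k, ε')) = 0) ∧
      ∀ i, 0 < D.E (bQ (i, 0)) (D.α (bQ (i, 0))) := by
  classical
  -- the field `K = ℚ[X]/(X² + d)` acting on `V` through `root ↦ α`
  set P : ℚ[X] := X ^ 2 + C D.d with hP
  haveI : Fact (Irreducible P) := ⟨irreducible_X_sq_add_C_of_pos D.d_pos⟩
  have hα : AdjoinRoot.root P * AdjoinRoot.root P = algebraMap ℚ (AdjoinRoot P) (-D.d) :=
    root_mul_root D.d
  have hK : ∀ k : AdjoinRoot P, ∃ a c : ℚ, k = algebraMap ℚ (AdjoinRoot P) a +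
      algebraMap ℚ (AdjoinRoot P) c * AdjoinRoot.root P := exists_eq_algebraMap_add_mul_root D.d
  obtain ⟨inst, hinst⟩ := exists_module_smul_eq D.d_pos hα hK D.α D.α_α
  letI : Module (AdjoinRoot P) V := inst
  haveI : IsScalarTower ℚ (AdjoinRoot P) V := hinst.1
  have hαv : ∀ v : V, AdjoinRoot.root P • v = D.α v := hinst.2
  haveI : Module.Finite (AdjoinRoot P) V := Module.Finite.of_restrictScalars_finite ℚ _ _
  have h2 : 2 * finrank (AdjoinRoot P) V = finrank ℚ V :=
    two_mul_finrank_eq_of_weilOperator D.d_pos hα hK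
  -- the hypotheses in `K`-form
  have hE' : ∀ x y : V, D.E x y = -D.E y x := fun x y => D.E_swap y x
  have hW : ∀ x y : V, D.E (AdjoinRoot.root P • x) (AdjoinRoot.root P • y) = D.d * D.E x y :=
    fun x y => by rw [hαv, hαv]; exact D.E_α x y
  have hjα' : ∀ x, j (AdjoinRoot.root P • x) = -(AdjoinRoot.root P • j x) := fun x => by
    rw [hαv, hαv]; exact hjα x
  have hN : ∀ y : V, (∀ x, D.E x y = 0) → y = 0 := fun y hy => D.E_nondegenerate.2 y hy
  -- the `j`-adapted orthogonal `K`-frame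
  obtain ⟨m, hm, e, hQ, horth, horthj⟩ := exists_typeII_orthogonalFrame D.d_pos hα hK hb.ne'
    (finrank (AdjoinRoot P) V) V rfl D.E D.E_swap hW hN j hjα' hjj hjE
  -- sign adjustment: `Q(xᵢ) > 0`
  have hQj : ∀ x : V, D.E (j x) (D.α (j x)) = -(b * D.E x (D.α x)) :=
    D.E_typeII_α_typeII j hjα hjj hjE
  let e' : Fin m → V := fun i => if 0 < D.E (e i) (D.α (e i)) then e i else j (e i)
  have he'pos : ∀ i, 0 < D.E (e' i) (D.α (e' i)) := fun i => by
    by_cases h : 0 < D.E (e i) (D.α (e i))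
    · simp only [e', if_pos h]; exact h
    · simp only [e', if_neg h]
      rw [hQj]
      have hne : D.E (e i) (D.α (e i)) ≠ 0 := by have := hQ i; rwa [hαv] at this
      have hlt : D.E (e i) (D.α (e i)) < 0 := lt_of_le_of_ne (not_lt.1 h) hne
      nlinarith
  -- the `K`-blocks `Sᵢ = K eᵢ ⊕ K j eᵢ` are pairwise `H`-orthogonal
  let S : Fin m → Submodule (AdjoinRoot P) V := fun i =>
    Submodule.span (AdjoinRoot P) {e i, j (e i)}
  have mem_e : ∀ i, e i ∈ S i := fun i => Submodule.subset_span (by simp)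
  have mem_je : ∀ i, j (e i) ∈ S i := fun i => Submodule.subset_span (by simp)
  have hH : ∀ i k, i ≠ k → ∀ x ∈ S i, ∀ y ∈ S k,
      weilHermitianForm D.E (AdjoinRoot.root P) x y = 0 := by
    intro i k hik
    have g11 : weilHermitianForm D.E (AdjoinRoot.root P) (e i) (e k) = 0 := horth i k hik
    have g12 : weilHermitianForm D.E (AdjoinRoot.root P) (e i) (j (e k)) = 0 := horthj i k hik
    have g21 : weilHermitianForm D.E (AdjoinRoot.root P) (j (e i)) (e k) = 0 :=
      weilHermitianForm_comm_eq_zero D.E D.d_pos hα hE' hW (horthj k i hik.symm)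
    have g22 : weilHermitianForm D.E (AdjoinRoot.root P) (j (e i)) (j (e k)) = 0 := by
      rw [weilHermitianForm_j_j D.E D.d_pos.ne' hα D.E_swap hW j hjα' hjj hjE, horth k i hik.symm,
        mul_zero]
    obtain ⟨T, hT⟩ := exists_submodule_weilOrthogonal D.E hα hK ({e i, j (e i)} : Set V)
    have hSk : S k ≤ T := by
      refine Submodule.span_le.2 ?_
      intro y hy
      simp only [Set.mem_insert_iff, Set.mem_singleton_iff] at hy
      refine (hT y).2 fun x hx => ?_
      simp only [Set.mem_insert_iff, Set.mem_singleton_iff] at hx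
      rcases hy with rfl | rfl <;> rcases hx with rfl | rfl
      exacts [g11, g21, g12, g22]
    intro x hx y hy
    obtain ⟨U, hU⟩ := exists_submodule_weilOrthogonal_left D.E D.d_pos hα hK hW y
    have hSi : S i ≤ U :=
      Submodule.span_le.2 fun x' hx' => (hU x').2 ((hT y).1 (hSk hy) x' hx')
    exact (hU x).1 (hSi hx)
  have hEblock : ∀ i k, i ≠ k → ∀ x ∈ S i, ∀ y ∈ S k, D.E x y = 0 :=
    fun i k hik x hx y hy => apply_eq_zero_of_weilHermitianForm_eq_zero D.E D.d_pos hα (hH i k hik x hx y hy)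
  -- memberships of the adjusted vectors
  have he'mem : ∀ i, e' i ∈ S i ∧ j (e' i) ∈ S i := fun i => by
    by_cases h : 0 < D.E (e i) (D.α (e i))
    · simp only [e', if_pos h]; exact ⟨mem_e i, mem_je i⟩
    · simp only [e', if_neg h]
      refine ⟨mem_je i, ?_⟩
      rw [hjj]
      exact Submodule.smul_of_tower_mem _ b (mem_e i)
  have hαmem : ∀ i, ∀ x ∈ S i, D.α x ∈ S i := fun i x hx => by
    rw [← hαv]; exact Submodule.smul_mem _ _ hx
  -- the `K`-family `wᵢ₀ = xᵢ`, `wᵢ₁ = j xᵢ` is `K`-linearly independent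
  let w : Fin m × Fin 2 → V := fun p => ![e' p.1, j (e' p.1)] p.2
  have hw0 : ∀ i, w (i, 0) = e' i := fun i => rfl
  have hw1 : ∀ i, w (i, 1) = j (e' i) := fun i => rfl
  have hwmem : ∀ p, w p ∈ S p.1 := by
    rintro ⟨i, s⟩
    fin_cases s
    · exact (he'mem i).1
    · exact (he'mem i).2
  have hwK : LinearIndependent (AdjoinRoot P) w := by
    refine linearIndependent_of_weilOrthogonal D.E hα hK D.E_swap (fun p q hpq => ?_) (fun p => ?_)
    · rcases p with ⟨i, s⟩
      rcases q with ⟨k, s'⟩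
      by_cases hik : i = k
      · subst hik
        have hss : s ≠ s' := fun h => hpq (by rw [h])
        fin_cases s <;> fin_cases s'
        · exact absurd rfl hss
        · exact weilHermitianForm_self_j D.E D.d_pos.ne' hα D.E_swap hW j hb.ne' hjα' hjj hjE (e' i)
        · exact weilHermitianForm_comm_eq_zero D.E D.d_pos hα hE' hW
            (weilHermitianForm_self_j D.E D.d_pos.ne' hα D.E_swap hW j hb.ne' hjα' hjj hjE (e' i))
        · exact absurd rfl hss
      · exact hH i k hik _ (hwmem (i, s)) _ (hwmem (k, s'))
    · rcases p with ⟨i, s⟩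
      rw [hαv]
      fin_cases s
      · exact (he'pos i).ne'
      · change D.E (j (e' i)) (D.α (j (e' i))) ≠ 0
        rw [hQj]
        have := he'pos i
        nlinarith
  -- the `ℚ`-family `(1, α) • w`, reindexed to `Fin m × Fin 4`
  have h1α : LinearIndependent ℚ (basisOneAlpha D.d_pos hα hK) :=
    (basisOneAlpha D.d_pos hα hK).linearIndependent
  have hprod := linearIndependent_smul h1α hwK
  let fa : Fin 4 → Fin 2 := ![0, 1, 0, 1]
  let fs : Fin 4 → Fin 2 := ![0, 0, 1, 1]
  let f : Fin m × Fin 4 → Fin 2 × (Fin m × Fin 2) := fun p => (fa p.2, (p.1, fs p.2))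
  have key : ∀ ε ε' : Fin 4, fa ε = fa ε' → fs ε = fs ε' → ε = ε' := by decide
  have hf : Function.Injective f := by
    rintro ⟨i, ε⟩ ⟨i', ε'⟩ h
    simp only [f, Prod.mk.injEq] at h
    exact Prod.ext h.2.1 (key ε ε' h.1 h.2.2)
  let v : Fin m × Fin 4 → V := (fun p : Fin 2 × (Fin m × Fin 2) => basisOneAlpha D.d_pos hα hK p.1 • w p.2) ∘ f
  have hv : LinearIndependent ℚ v := hprod.comp f hf
  have hv0 : ∀ i, v (i, 0) = e' i := fun i => by
    simp only [v, f, fa, fs, Function.comp_apply, Matrix.cons_val_zero]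
    rw [basisOneAlpha_apply_zero, one_smul, hw0]
  have hv1 : ∀ i, v (i, 1) = D.α (e' i) := fun i => by
    simp only [v, f, fa, fs, Function.comp_apply, Matrix.cons_val_one, Matrix.cons_val_zero]
    rw [basisOneAlpha_apply_one, hw0, hαv]
  have hv2 : ∀ i, v (i, 2) = j (e' i) := fun i => by
    simp only [v, f, fa, fs, Function.comp_apply]
    rw [show (![0, 1, 0, 1] : Fin 4 → Fin 2) 2 = 0 from rfl, show (![0, 0, 1, 1] : Fin 4 → Fin 2) 2 = 1 from rfl,
      basisOneAlpha_apply_zero, one_smul, hw1]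
  have hv3 : ∀ i, v (i, 3) = D.α (j (e' i)) := fun i => by
    simp only [v, f, fa, fs, Function.comp_apply]
    rw [show (![0, 1, 0, 1] : Fin 4 → Fin 2) 3 = 1 from rfl, show (![0, 0, 1, 1] : Fin 4 → Fin 2) 3 = 1 from rfl,
      basisOneAlpha_apply_one, hw1, hαv]
  have hvmem : ∀ i ε, v (i, ε) ∈ S i := fun i ε => by
    fin_cases ε
    · show v (i, 0) ∈ S i
      rw [hv0]; exact (he'mem i).1
    · show v (i, 1) ∈ S i
      rw [hv1]; exact hαmem i _ (he'mem i).1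
    · show v (i, 2) ∈ S i
      rw [hv2]; exact (he'mem i).2
    · show v (i, 3) ∈ S i
      rw [hv3]; exact hαmem i _ (he'mem i).2
  -- dimension count: `4m = dim_ℚ V`
  have hcard : Fintype.card (Fin m × Fin 4) = finrank ℚ V := by
    rw [Fintype.card_prod, Fintype.card_fin, Fintype.card_fin]
    omega
  let bQ : Basis (Fin m × Fin 4) ℚ V := basisOfLinearIndependentOfCardEqFinrank' v hv hcard
  have hbQ : ∀ p, bQ p = v p := fun p => by
    rw [coe_basisOfLinearIndependentOfCardEqFinrank']
  refine ⟨m, by omega, bQ, fun i => ?_, fun i => ?_, fun i => ?_, fun i k hik ε ε' => ?_, fun i => ?_⟩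
  · rw [hbQ, hbQ, hv1, hv0]
  · rw [hbQ, hbQ, hv2, hv0]
  · rw [hbQ, hbQ, hv3, hv0]
  · rw [hbQ, hbQ]
    exact hEblock i k hik _ (hvmem i ε) _ (hvmem k ε')
  · rw [hbQ, hv0]
    exact he'pos i

/-! ## §3 The real type-II quaternionic frame of a Weil datum (input of `TypeIIQuaternionFrame`) -/

/-- **The realification of the rational type-II frame is a `TypeIIQuaternionFrame.Frame`** on
`W = V_ℝ` with `A = α_ℝ`, `B = j_ℝ`, `E = E_ℝ`, `β = √b`, and frame basis `1 ⊗ xᵢ, 1 ⊗ αxᵢ, 1 ⊗ jxᵢ, 1 ⊗ αjxᵢ`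
the base change of a RATIONAL basis — so that the explicit family `J(P, t)` of
`Motives/TypeIIQuaternionFrame`, `Motives/TypeIIGenericCommutant` lives on the Weil datum itself.
[cite: vanGeemenVerra2003QuaternionicPryms, Lemma 4.5 (proof)] [cite: vanGeemen1994HodgeAV, 5.3–5.6] -/
theorem exists_typeIIFrame [FiniteDimensional ℚ V] (j : V →ₗ[ℚ] V) {b : ℚ}
    (hjα : ∀ x, j (D.α x) = -(D.α (j x))) (hjj : ∀ x, j (j x) = b • x)
    (hjE : ∀ x y, D.E (j x) y = D.E x (j y)) (hb : 0 < b) :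
    ∃ (n : ℕ) (bQ : Basis (Fin n × Fin 4) ℚ V)
      (F : TypeIIQuaternionFrame.Frame (ℝ ⊗[ℚ] V) n (D.d : ℝ) (b : ℝ) (Real.sqrt b)),
      finrank ℚ V = 4 * n ∧ F.A = D.αℝ ∧ F.B = j.baseChange ℝ ∧ F.E = D.Eℝ ∧
        ∀ p, F.bas p = (1 : ℝ) ⊗ₜ bQ p := by
  obtain ⟨n, hn, bQ, h1, h2, h3, horth, hpos⟩ := D.exists_typeII_rationalBasis j hjα hjj hjE hb
  have hb' : (0 : ℝ) < b := by exact_mod_cast hb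
  refine ⟨n, bQ,
    { A := D.αℝ, B := j.baseChange ℝ, E := D.Eℝ, bas := Algebra.TensorProduct.basis ℝ bQ,
      d_pos := by exact_mod_cast D.d_pos, β_pos := Real.sqrt_pos.2 hb',
      β_mul_β := Real.mul_self_sqrt hb'.le,
      A_A := D.αℝ_αℝ, B_B := baseChange_baseChange_of_comp_self j hjj,
      A_B := fun w => by rw [D.baseChange_αℝ_of_anticomm j hjα, neg_neg],
      E_swap := fun v w => D.Eℝ_swap v w, E_A := D.Eℝ_αℝ_left,
      E_B := D.Eℝ_baseChange_left j hjE,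
      bas_one := fun i => by
        rw [Algebra.TensorProduct.basis_apply, Algebra.TensorProduct.basis_apply, h1, αℝ_tmul],
      bas_two := fun i => by
        rw [Algebra.TensorProduct.basis_apply, Algebra.TensorProduct.basis_apply, h2,
          LinearMap.baseChange_tmul],
      bas_three := fun i => by
        rw [Algebra.TensorProduct.basis_apply, Algebra.TensorProduct.basis_apply, h3,
          LinearMap.baseChange_tmul, αℝ_tmul],
      orth := fun i k hik ε ε' => by
        rw [Algebra.TensorProduct.basis_apply, Algebra.TensorProduct.basis_apply, Eℝ_tmul,
          horth i k hik ε ε', Rat.cast_zero, mul_zero],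
      pos := fun i => by
        rw [Algebra.TensorProduct.basis_apply, αℝ_tmul, Eℝ_tmul, one_mul, one_mul]
        exact_mod_cast hpos i }, hn, rfl, rfl, rfl, fun p => Algebra.TensorProduct.basis_apply bQ p⟩

/-! ## §4 The explicit family `J(P, t)` lies in the type-II sub-domain `𝔖(j)`; its common Hodge endomorphisms -/

section Family

open TypeIIQuaternionFrame

variable {n : ℕ} {b : ℚ} {β : ℝ} (F : Frame (ℝ ⊗[ℚ] V) n (D.d : ℝ) (b : ℝ) β) (j : V →ₗ[ℚ] V)

omit D in
/-- `(1 : ℝ) ⊗ (c • w) = (c : ℝ) • (1 ⊗ w)` for `c ∈ ℚ` (private helper). [folklore] -/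
private theorem one_tmul_ratSmul (c : ℚ) (w : V) : (1 : ℝ) ⊗ₜ[ℚ] (c • w) = (c : ℝ) • ((1 : ℝ) ⊗ₜ[ℚ] w) := by
  rw [TensorProduct.tmul_smul, ← algebraMap_smul ℝ c ((1 : ℝ) ⊗ₜ[ℚ] w), eq_ratCast]

omit D in
/-- `v ↦ 1 ⊗ v : V → V_ℝ` is injective (`V` free over `ℚ`; private helper). [folklore] -/
private theorem one_tmul_injective {ι : Type*} (bQ : Basis ι ℚ V) {v w : V}
    (h : (1 : ℝ) ⊗ₜ[ℚ] v = (1 : ℝ) ⊗ₜ[ℚ] w) : v = w := by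
  have h' := congrArg (Algebra.TensorProduct.basis ℝ bQ).repr h
  simp only [Algebra.TensorProduct.basis_repr_tmul, one_smul] at h'
  apply bQ.repr.injective
  ext i
  have hi := DFunLike.congr_fun h' i
  simp only [Finsupp.mapRange_apply] at hi
  exact (algebraMap ℚ ℝ).injective hi

variable [NeZero n] (hA : F.A = D.αℝ) (hB : F.B = j.baseChange ℝ) (hE : F.E = D.Eℝ)
include hA hB hE

/-- **The explicit family lies in the type-II sub-domain.** For a type-II quaternionic frame `F` of the Weil
datum (`A = α_ℝ`, `B = j_ℝ`, `E = E_ℝ`), each member `J(P, t)` (`Pᵢ ≠ 0`, `t ∈ ℝ`) of the explicit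
`(n+1)`-parameter family of `Motives/TypeIIGenericCommutant` is (the realification of) a point of Deligne's
`X⁺(D)` — a `ℂ`-linear complex structure of `(V_ℝ, i)` with the Riemann relations,
`IsWeilComplexStructure D.hForm J` — which COMMUTES with `j_ℝ`: a point of `𝔖(j) = {J ∈ X⁺(D) : J j_ℝ = j_ℝ J}`
(hence, by §1, a fibre carrying `D = K ⊕ Kj` by Hodge endomorphisms). [cite: vanGeemen1994HodgeAV, 5.5–5.7]
[cite: Shimura1963AnalyticFamilies, §4] [cite: Deligne1982HodgeCycles, proof of Thm. 4.8, p. 47 (a′), (b′)] -/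
theorem exists_isWeilComplexStructure_realJ_eq_JP (P : Fin n → ℝ) (hP : ∀ i, P i ≠ 0) (t : ℝ) :
    ∃ J : D.Cx →ₗ[ℂ] D.Cx, IsWeilComplexStructure D.hForm J ∧ D.realJ J = F.JP P t ∧
      ∀ a, j.baseChange ℝ (D.realJ J a) = D.realJ J (j.baseChange ℝ a) := by
  have hI : ∀ x, F.JP P t (D.I₀ x) = D.I₀ (F.JP P t x) := fun x => by
    rw [I₀_apply, I₀_apply, map_smul, ← hA, F.A_JP]
  let J : D.Cx →ₗ[ℂ] D.Cx :=
    { toFun := fun x => D.toCx (F.JP P t (D.ofCx x))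
      map_add' := fun x y => by
        change D.toCx (F.JP P t (D.ofCx x + D.ofCx y)) = _
        rw [map_add, map_add]
      map_smul' := fun z x => by
        rw [ofCx_smul, map_add, map_smul, map_smul, hI, RingHom.id_apply, smul_toCx] }
  have hJ : ∀ x, J x = D.toCx (F.JP P t (D.ofCx x)) := fun _ => rfl
  have hrealJ : D.realJ J = F.JP P t := LinearMap.ext fun _ => rfl
  refine ⟨J, (D.isWeilComplexStructure_iff J).2 ⟨fun x => ?_, fun x y => ?_, fun x hx => ?_⟩, hrealJ,
    fun a => ?_⟩
  · rw [hJ, hJ, ofCx_toCx, F.JP_JP P hP, map_neg, toCx_ofCx]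
  · rw [hJ, hJ, ofCx_toCx, ofCx_toCx, ← hE, F.E_JP_JP P hP]
  · rw [hJ, ofCx_toCx, ← hE]
    exact F.E_JP_pos P hP t fun h => hx (by rw [← D.toCx_ofCx x, h, map_zero])
  · rw [hrealJ, ← hB, F.B_JP]

/-- **The common Hodge endomorphisms of the explicit type-II family are `ℚ + ℚα + ℚj + ℚαj`.** Let `F` be a
type-II quaternionic frame of the Weil datum whose frame basis is the base change of a rational basis `bQ`. If a
`ℚ`-linear `g` is a Hodge endomorphism of the fibre `D.hodgeStructure J` for every point `J ∈ X⁺(D)` realifying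
to a member `J(P, t)` (`Pᵢ > 0`, `t > 0`) of the family, then `g = c₀ + c₁α + c₂j + c₃αj` with `cᵢ ∈ ℚ`.
Proof: by §1 `g_ℝ` commutes with every `J(P, t)`, so `g_ℝ = λ(δ)`, `δ ∈ D_ℝ`
(`Frame.exists_eq_lam_of_forall_comm_JP`); evaluating at the rational frame vector `x₁` and reading
coordinates in the rational basis shows `δ ∈ ℚ⁴`, and `v ↦ 1 ⊗ v` is injective. This is the Hodge-theoretic
content of "the generic member of the type-II family has endomorphism algebra `D`", in fixed-part form.
[cite: Shimura1963AnalyticFamilies, §4] [cite: vanGeemen1994HodgeAV, proof of Thm. 6.11] -/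
theorem exists_eq_of_forall_JP_mem_endAlg (bQ : Basis (Fin n × Fin 4) ℚ V)
    (hbas : ∀ p, F.bas p = (1 : ℝ) ⊗ₜ bQ p) (g : V →ₗ[ℚ] V)
    (hg : ∀ P : Fin n → ℝ, (∀ i, 0 < P i) → ∀ t : ℝ, 0 < t →
      ∀ (J : D.Cx →ₗ[ℂ] D.Cx) (hW : IsWeilComplexStructure D.hForm J),
        D.realJ J = F.JP P t → g ∈ (D.hodgeStructure J hW.sq).endAlg) :
    ∃ c₀ c₁ c₂ c₃ : ℚ, g = c₀ • 1 + c₁ • D.α + c₂ • j + c₃ • (D.α * j) := by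
  classical
  -- `g_ℝ` commutes with the whole family
  have hcomm : ∀ P : Fin n → ℝ, (∀ i, 0 < P i) → ∀ t : ℝ, 0 < t →
      g.baseChange ℝ ∘ₗ F.JP P t = F.JP P t ∘ₗ g.baseChange ℝ := by
    intro P hP t ht
    obtain ⟨J, hW, hJ, -⟩ :=
      D.exists_isWeilComplexStructure_realJ_eq_JP F j hA hB hE P (fun i => (hP i).ne') t
    have h := (D.mem_endAlg_hodgeStructure_iff J hW.sq g).1 (hg P hP t ht J hW hJ)
    rw [hJ] at h
    exact LinearMap.ext fun a => h a
  -- hence `g_ℝ = λ(δ)` for a real quaternion `δ`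
  obtain ⟨δ, hδ⟩ := F.exists_eq_lam_of_forall_comm_JP (g.baseChange ℝ) hcomm
  have hlam : ∀ v : V, (1 : ℝ) ⊗ₜ[ℚ] g v = δ.re • ((1 : ℝ) ⊗ₜ[ℚ] v) + δ.imI • ((1 : ℝ) ⊗ₜ[ℚ] D.α v) +
      δ.imJ • ((1 : ℝ) ⊗ₜ[ℚ] j v) + δ.imK • ((1 : ℝ) ⊗ₜ[ℚ] D.α (j v)) := fun v => by
    have h := LinearMap.congr_fun hδ ((1 : ℝ) ⊗ₜ[ℚ] v)
    rw [LinearMap.baseChange_tmul, F.lam_apply, hA, hB, LinearMap.baseChange_tmul, αℝ_tmul,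
      αℝ_tmul] at h
    exact h
  -- the coordinates of `δ` are rational: read them off at the rational frame vector `x₀`
  have hbas' : F.bas = Algebra.TensorProduct.basis ℝ bQ :=
    Basis.eq_of_apply_eq fun p => by rw [hbas, Algebra.TensorProduct.basis_apply]
  set e0 : V := bQ (0, 0) with he0
  have hx1 : (1 : ℝ) ⊗ₜ[ℚ] D.α e0 = F.bas (0, 1) := by
    rw [F.bas_one, hbas, hA, αℝ_tmul]
  have hx2 : (1 : ℝ) ⊗ₜ[ℚ] j e0 = F.bas (0, 2) := by
    rw [F.bas_two, hbas, hB, LinearMap.baseChange_tmul]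
  have hx3 : (1 : ℝ) ⊗ₜ[ℚ] D.α (j e0) = F.bas (0, 3) := by
    rw [F.bas_three, hbas, hA, hB, LinearMap.baseChange_tmul, αℝ_tmul]
  have key := hlam e0
  rw [← hbas (0, 0), hx1, hx2, hx3] at key
  have hcoord : ∀ p, F.bas.repr ((1 : ℝ) ⊗ₜ[ℚ] g e0) p = (bQ.repr (g e0) p : ℝ) := fun p => by
    rw [hbas', Algebra.TensorProduct.basis_repr_tmul, one_smul, Finsupp.mapRange_apply, eq_ratCast]
  have hre : δ.re = (bQ.repr (g e0) (0, 0) : ℝ) := by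
    have h := hcoord (0, 0)
    rw [key] at h
    simpa [Finsupp.single_apply] using h
  have himI : δ.imI = (bQ.repr (g e0) (0, 1) : ℝ) := by
    have h := hcoord (0, 1)
    rw [key] at h
    simpa [Finsupp.single_apply] using h
  have himJ : δ.imJ = (bQ.repr (g e0) (0, 2) : ℝ) := by
    have h := hcoord (0, 2)
    rw [key] at h
    simpa [Finsupp.single_apply] using h
  have himK : δ.imK = (bQ.repr (g e0) (0, 3) : ℝ) := by
    have h := hcoord (0, 3)
    rw [key] at h
    simpa [Finsupp.single_apply] using h
  refine ⟨bQ.repr (g e0) (0, 0), bQ.repr (g e0) (0, 1), bQ.repr (g e0) (0, 2), bQ.repr (g e0) (0, 3),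
    LinearMap.ext fun v => one_tmul_injective bQ ?_⟩
  rw [hlam v, hre, himI, himJ, himK]
  simp only [LinearMap.add_apply, LinearMap.smul_apply, Module.End.one_apply, Module.End.mul_apply,
    TensorProduct.tmul_add, one_tmul_ratSmul]

/-- `End_Hdg` form of `exists_eq_of_forall_JP_mem_endAlg`: such a `g` lies in `ℚ⟨α, j⟩ = K ⊕ Kj = D`.
[cite: Shimura1963AnalyticFamilies, §4] [cite: vanGeemen1994HodgeAV, proof of Thm. 6.11] -/
theorem mem_adjoin_of_forall_JP_mem_endAlg (bQ : Basis (Fin n × Fin 4) ℚ V)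
    (hbas : ∀ p, F.bas p = (1 : ℝ) ⊗ₜ bQ p) (g : V →ₗ[ℚ] V)
    (hg : ∀ P : Fin n → ℝ, (∀ i, 0 < P i) → ∀ t : ℝ, 0 < t →
      ∀ (J : D.Cx →ₗ[ℂ] D.Cx) (hW : IsWeilComplexStructure D.hForm J),
        D.realJ J = F.JP P t → g ∈ (D.hodgeStructure J hW.sq).endAlg) :
    g ∈ Algebra.adjoin ℚ {D.α, j} := by
  obtain ⟨c₀, c₁, c₂, c₃, rfl⟩ := D.exists_eq_of_forall_JP_mem_endAlg F j hA hB hE bQ hbas g hg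
  have hα : D.α ∈ Algebra.adjoin ℚ {D.α, j} := Algebra.subset_adjoin (by simp)
  have hj : j ∈ Algebra.adjoin ℚ {D.α, j} := Algebra.subset_adjoin (by simp)
  refine add_mem (add_mem (add_mem ?_ ?_) ?_) ?_
  · exact Subalgebra.smul_mem _ (Subalgebra.one_mem _) c₀
  · exact Subalgebra.smul_mem _ hα c₁
  · exact Subalgebra.smul_mem _ hj c₂
  · exact Subalgebra.smul_mem _ (Subalgebra.mul_mem _ hα hj) c₃

end Family

/-! ## §5 The generic endomorphism algebra of the type-II Weil family is `D = K ⊕ Kj` (fixed-part form) -/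

/-- **MAIN THEOREM (Shimura 1963 §4, fixed-part form, on the rational Weil datum).** Let `D = (V, α, E)` be a
finite-dimensional Weil datum (`K = ℚ(α)`, `α² = -d`) with a type-II operator `j` — `ℚ`-linear, `K`-antilinear
(`jα = -αj`), `j² = b > 0`, Rosati-symmetric for `E` (so `D := K ⊕ Kj = (-d, b)_ℚ` is an indefinite quaternion
algebra acting on `V`, Albert type II). If a `ℚ`-linear endomorphism `g` of `V` is a HODGE ENDOMORPHISM OF EVERY
FIBRE OVER THE TYPE-II SUB-DOMAIN — `g ∈ End_Hdg(D.hodgeStructure J)` for every `J ∈ X⁺(D)` commuting with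
`j_ℝ` — then `g = c₀ + c₁α + c₂j + c₃αj ∈ D` (`cᵢ ∈ ℚ`). With §1 (`D ⊆ End_Hdg` of every such fibre): **the
common endomorphism algebra of the Hodge structures of the type-II family `𝔖(j)` is exactly `D`** — the
fixed-part form of "the generic member of the analytic family of type II has `End⁰ = D`" [Shimura §4], by
van Geemen's mechanism [proof of Thm. 6.11] made explicit: already the `(n+1)`-parameter real-algebraic
sub-family `J(P, t)` of `𝔖(j)` through the diagonal CM point has joint commutant `D_ℝ`
(`Motives/TypeIIGenericCommutant`), and `End_ℚ(V) ∩ D_ℝ = D`. HONEST REMARKS: this is the statement about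
the FAMILY (equivalently: for each `g ∉ D` the locus of `J ∈ 𝔖(j)` where `g` is Hodge is a PROPER subset);
the single very general member (`End_Hdg = D` for one `J`, a Baire/transcendence statement), simplicity of
the generic member, and anything about abelian varieties (period map, Riemann's theorem) are NOT asserted here.
[cite: Shimura1963AnalyticFamilies, §4] [cite: vanGeemen1994HodgeAV, 5.5–5.8 and proof of Thm. 6.11] -/
theorem exists_eq_of_forall_typeII_mem_endAlg [FiniteDimensional ℚ V] (j : V →ₗ[ℚ] V) {b : ℚ}
    (hjα : ∀ x, j (D.α x) = -(D.α (j x))) (hjj : ∀ x, j (j x) = b • x)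
    (hjE : ∀ x y, D.E (j x) y = D.E x (j y)) (hb : 0 < b) (g : V →ₗ[ℚ] V)
    (hg : ∀ (J : D.Cx →ₗ[ℂ] D.Cx) (hW : IsWeilComplexStructure D.hForm J),
      (∀ a, j.baseChange ℝ (D.realJ J a) = D.realJ J (j.baseChange ℝ a)) →
        g ∈ (D.hodgeStructure J hW.sq).endAlg) :
    ∃ c₀ c₁ c₂ c₃ : ℚ, g = c₀ • 1 + c₁ • D.α + c₂ • j + c₃ • (D.α * j) := by
  obtain ⟨n, bQ, F, hn, hA, hB, hE, hbas⟩ := D.exists_typeIIFrame j hjα hjj hjE hb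
  rcases Nat.eq_zero_or_pos n with rfl | hn0
  · -- `V = 0`
    have hV : finrank ℚ V = 0 := by simpa using hn
    haveI : Subsingleton V := Module.finrank_zero_iff.1 hV
    refine ⟨0, 0, 0, 0, LinearMap.ext fun v => ?_⟩
    simp [Subsingleton.elim v 0]
  · haveI : NeZero n := ⟨hn0.ne'⟩
    exact D.exists_eq_of_forall_JP_mem_endAlg F j hA hB hE bQ hbas g fun P _ t _ J hW hJ =>
      hg J hW fun a => by rw [hJ, ← hB, F.B_JP]

/-- `End_Hdg` form of the main theorem: `g ∈ ℚ⟨α, j⟩ = D`.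
[cite: Shimura1963AnalyticFamilies, §4] [cite: vanGeemen1994HodgeAV, proof of Thm. 6.11] -/
theorem mem_adjoin_of_forall_typeII_mem_endAlg [FiniteDimensional ℚ V] (j : V →ₗ[ℚ] V) {b : ℚ}
    (hjα : ∀ x, j (D.α x) = -(D.α (j x))) (hjj : ∀ x, j (j x) = b • x)
    (hjE : ∀ x y, D.E (j x) y = D.E x (j y)) (hb : 0 < b) (g : V →ₗ[ℚ] V)
    (hg : ∀ (J : D.Cx →ₗ[ℂ] D.Cx) (hW : IsWeilComplexStructure D.hForm J),
      (∀ a, j.baseChange ℝ (D.realJ J a) = D.realJ J (j.baseChange ℝ a)) →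
        g ∈ (D.hodgeStructure J hW.sq).endAlg) :
    g ∈ Algebra.adjoin ℚ {D.α, j} := by
  obtain ⟨c₀, c₁, c₂, c₃, rfl⟩ := D.exists_eq_of_forall_typeII_mem_endAlg j hjα hjj hjE hb g hg
  have hα : D.α ∈ Algebra.adjoin ℚ {D.α, j} := Algebra.subset_adjoin (by simp)
  have hj : j ∈ Algebra.adjoin ℚ {D.α, j} := Algebra.subset_adjoin (by simp)
  refine add_mem (add_mem (add_mem ?_ ?_) ?_) ?_
  · exact Subalgebra.smul_mem _ (Subalgebra.one_mem _) c₀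
  · exact Subalgebra.smul_mem _ hα c₁
  · exact Subalgebra.smul_mem _ hj c₂
  · exact Subalgebra.smul_mem _ (Subalgebra.mul_mem _ hα hj) c₃

/-- **`⋂_{J ∈ 𝔖(j)} End_Hdg(V, J) = ℚ⟨α, j⟩ = D`** — the two inclusions of §1 and of the main theorem as one
characterization of the rational endomorphisms that are Hodge on the whole type-II family.
[cite: Shimura1963AnalyticFamilies, §4] [cite: vanGeemen1994HodgeAV, 5.7 and proof of Thm. 6.11] -/
theorem forall_typeII_mem_endAlg_iff [FiniteDimensional ℚ V] (j : V →ₗ[ℚ] V) {b : ℚ}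
    (hjα : ∀ x, j (D.α x) = -(D.α (j x))) (hjj : ∀ x, j (j x) = b • x)
    (hjE : ∀ x y, D.E (j x) y = D.E x (j y)) (hb : 0 < b) (g : V →ₗ[ℚ] V) :
    (∀ (J : D.Cx →ₗ[ℂ] D.Cx) (hW : IsWeilComplexStructure D.hForm J),
      (∀ a, j.baseChange ℝ (D.realJ J a) = D.realJ J (j.baseChange ℝ a)) →
        g ∈ (D.hodgeStructure J hW.sq).endAlg) ↔ g ∈ Algebra.adjoin ℚ {D.α, j} :=
  ⟨D.mem_adjoin_of_forall_typeII_mem_endAlg j hjα hjj hjE hb g, fun hg J hW hcomm =>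
    D.adjoin_le_endAlg_hodgeStructure_of_comm j J hW.sq hcomm hg⟩

/-- The same as an equality of `ℚ`-subalgebras of `End_ℚ(V)`: the infimum over the type-II sub-domain
`𝔖(j)` of the endomorphism algebras of the fibres is `ℚ⟨α, j⟩`.
[cite: Shimura1963AnalyticFamilies, §4] [cite: vanGeemen1994HodgeAV, 5.7 and proof of Thm. 6.11] -/
theorem iInf_endAlg_typeII_eq_adjoin [FiniteDimensional ℚ V] (j : V →ₗ[ℚ] V) {b : ℚ}
    (hjα : ∀ x, j (D.α x) = -(D.α (j x))) (hjj : ∀ x, j (j x) = b • x)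
    (hjE : ∀ x y, D.E (j x) y = D.E x (j y)) (hb : 0 < b) :
    ⨅ J : {J : D.Cx →ₗ[ℂ] D.Cx // IsWeilComplexStructure D.hForm J ∧
        ∀ a, j.baseChange ℝ (D.realJ J a) = D.realJ J (j.baseChange ℝ a)},
      (D.hodgeStructure J.1 J.2.1.sq).endAlg = Algebra.adjoin ℚ {D.α, j} := by
  refine le_antisymm (fun g hg => ?_)
    (le_iInf fun J => D.adjoin_le_endAlg_hodgeStructure_of_comm j J.1 _ J.2.2)
  rw [Algebra.mem_iInf] at hg
  exact D.mem_adjoin_of_forall_typeII_mem_endAlg j hjα hjj hjE hb g fun J hW hcomm => hg ⟨J, hW, hcomm⟩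

/-- **Separation form** (how the fixed-part statement is used for "very general" members): every rational
endomorphism NOT in `D = ℚ⟨α, j⟩` fails to be a Hodge endomorphism at SOME point of the type-II sub-domain —
the locus `{J ∈ 𝔖(j) : g ∈ End_Hdg(V, J)}` is a proper subset for each of the countably many `g ∈ End_ℚ(V) ∖ D`.
[cite: Shimura1963AnalyticFamilies, §4] [cite: vanGeemen1994HodgeAV, proof of Thm. 6.11] -/
theorem exists_typeII_not_mem_endAlg [FiniteDimensional ℚ V] (j : V →ₗ[ℚ] V) {b : ℚ}
    (hjα : ∀ x, j (D.α x) = -(D.α (j x))) (hjj : ∀ x, j (j x) = b • x)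
    (hjE : ∀ x y, D.E (j x) y = D.E x (j y)) (hb : 0 < b) (g : V →ₗ[ℚ] V)
    (hg : g ∉ Algebra.adjoin ℚ {D.α, j}) :
    ∃ (J : D.Cx →ₗ[ℂ] D.Cx) (hW : IsWeilComplexStructure D.hForm J),
      (∀ a, j.baseChange ℝ (D.realJ J a) = D.realJ J (j.baseChange ℝ a)) ∧
        g ∉ (D.hodgeStructure J hW.sq).endAlg := by
  by_contra h
  push Not at h
  exact hg (D.mem_adjoin_of_forall_typeII_mem_endAlg j hjα hjj hjE hb g fun J hW hcomm => h J hW hcomm)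

end WeilDatum

end Literature.AlgebraicGeometry.Motives

end
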